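import Summits.BirchSwinnertonDyer.Rank1Residual.Iwasawa.RankGrowthLayer
import Literature.NumberTheory.EllipticCurves.Greenberg1999.MordellWeilRankLayerBoundProofs
import HarnessLib

/-!
# Rank-growth certificates ⇒ λ-lower bounds, BINDER-FREE (Greenberg Thm. 1.9 supplied by its proof)
# (cell `b2b-bsdres`; prover unit `b2b-bsdres-additive-p3`, gen 14; sequel of `Iwasawa/RankGrowthLayer.lean`)

HONEST FRAMING (run/shared/lean/b2b/bsd-rank1-residual/, verbatim in every file): the goal of the
cell is to DELETE the COMBINATION-SHAPED residual classes of the Birch–Swinnerton-Dyer formula for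
ALL analytic-rank `≤ 1` elliptic curves over `ℚ` — "full BSD formula for every rank `≤ 1` curve in
class `C`" assembled STRICTLY from published theorems — so that the rank-`≤ 1` remainder becomes
exactly the CONSTRUCTION-SHAPED classes, which are TYPED (missing-input `Prop`s), NOT attempted.
This is not "finishing BSD". THEOREMS ONLY; no named fact; nothing about any particular curve is
asserted; nothing booked; no label changes.

`Iwasawa/RankGrowthLayer.lean` turns a rank-growth certificate `LayerRankGEAt W p k m`
(`m ≤ rank E(ℚ_k)`) into the typed λ-lower bounds `LamAlgGEAt W p m` / `AlgebraicLambdaGE W p m` of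
the cell's main-conjecture squeezes GRANTED the binder
`hG : Greenberg1999.thm19_mordellWeilRank_layer_le_lambdaInvariant` (Greenberg, LNM 1716, Thm. 1.9,
registry A158). That binder is a THEOREM of the tree
(`Greenberg1999.thm19_mordellWeilRank_layer_le_lambdaInvariant_holds`,
`Literature/…/Greenberg1999/MordellWeilRankLayerBoundProofs.lean`, this unit), so every consumer is
restated here WITHOUT it: the census's 44 rank-growth squeeze closures (IWASAWA-CENSUS §13–§15:
X11b 41, X10 3) and the reducible route-T instances (X1, X2) rest on published theorems (Kato /
Wuthrich, as binders) + two certificates (`UnitCoeffAt`, `LayerRankGEAt`) + kernel theorems only.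
-/

noncomputable section

open scoped Classical

open scoped MatrixGroups ModularForm

open CongruenceSubgroup WeierstrassCurve Literature.NumberTheory.EllipticCurves
  Literature.NumberTheory.EllipticCurves.ModularForms
  Literature.NumberTheory.EllipticCurves.Rank1Residual
  Literature.NumberTheory.EllipticCurves.Rank1Residual.Typed
  Literature.NumberTheory.EllipticCurves.Wuthrich2014
  Literature.NumberTheory.EllipticCurves.GreenbergVatsal2000
  Literature.NumberTheory.EllipticCurves.Greenberg1999
  Summit.BirchSwinnertonDyer.Rank1Residual.X1.MuLambda
  Summit.BirchSwinnertonDyer.Rank1Residual.X1.ParitySqueeze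
  Summit.BirchSwinnertonDyer.Rank1Residual.X11a

set_option autoImplicit false

namespace Summit.BirchSwinnertonDyer.Rank1Residual.Iwasawa

variable (W : WeierstrassCurve ℚ) [W.IsElliptic] [W.IsGloballyMinimal] (p : ℕ) [Fact p.Prime]

/-- **Rank-growth certificate ⇒ `LamAlgGEAt`, binder-free**: `lamAlgGEAt_of_layerRankGEAt` with
Greenberg's Thm. 1.9 supplied by its kernel proof
(`thm19_mordellWeilRank_layer_le_lambdaInvariant_holds`). [cite: GreenbergLNM1716, Thm. 1.9 (PDF p. 63)]
[cite: GreenbergVatsal2000, p. 4 (after Thm. (1.2))] -/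
theorem lamAlgGEAt_of_layerRankGEAt' (hKato : kato_charIdeal_dvd_multiplicative_of_surjective)
    (hp2 : p ≠ 2) (hmult : W.HasMultiplicativeReductionAtPrime p)
    (hsurj' : ∀ n : ℕ, W.HasSurjectiveModNGaloisRep (p ^ n : ℕ)) (hμ : MuAnZeroAt W p)
    {k m : ℕ} (hm : LayerRankGEAt W p k m) : LamAlgGEAt W p m :=
  lamAlgGEAt_of_layerRankGEAt W p thm19_mordellWeilRank_layer_le_lambdaInvariant_holds hKato hp2
    hmult hsurj' hμ hm

/-- **Rank growth ⇒ Mazur's main conjecture at a multiplicative Kato-integral pair, binder-free in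
Thm. 1.9**: certificate `UnitCoeffAt W p m` + certificate `LayerRankGEAt W p k m` + Kato (binder) +
`μ_an = 0` ⇒ `X2.MazurMainConjectureAt W p`. [cite: GreenbergLNM1716, Thm. 1.9 (PDF p. 63)]
[cite: SteinWuthrich2013, §11 remark (p. 29)] -/
theorem mazurMainConjectureAt_of_unitCoeffAt_of_layerRankGEAt'
    (hKato : kato_charIdeal_dvd_multiplicative_of_surjective)
    (hp2 : p ≠ 2) (hmult : W.HasMultiplicativeReductionAtPrime p)
    (hsurj' : ∀ n : ℕ, W.HasSurjectiveModNGaloisRep (p ^ n : ℕ)) (hμ : MuAnZeroAt W p)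
    {k m : ℕ} (hcert : UnitCoeffAt W p m) (hm : LayerRankGEAt W p k m) :
    X2.MazurMainConjectureAt W p :=
  mazurMainConjectureAt_of_unitCoeffAt_of_layerRankGEAt W p
    thm19_mordellWeilRank_layer_le_lambdaInvariant_holds hKato hp2 hmult hsurj' hμ hcert hm

variable {W p}

/-- **Certificate ⇒ `AlgebraicLambdaGE`, binder-free** (good ordinary or multiplicative `p`).
[cite: GreenbergLNM1716, Thm. 1.9 (PDF p. 63)] -/
theorem algebraicLambdaGE_of_layerRankGEAt'
    (hop : IsOrdinaryAt W p ∨ W.HasMultiplicativeReductionAtPrime p) {k m : ℕ}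
    (hm : LayerRankGEAt W p k m) : X1.TamagawaSqueeze.AlgebraicLambdaGE W p m :=
  algebraicLambdaGE_of_layerRankGEAt thm19_mordellWeilRank_layer_le_lambdaInvariant_holds hop hm

/-- **X1 route T from a rank-growth certificate, binder-free in Thm. 1.9.**
[cite: GreenbergLNM1716, Thm. 1.9 (p. 63)] [cite: Wuthrich2014, Thm. 16 (p. 397)] -/
theorem mazurMainConjecture_of_layerRankGEAt'
    (hW16 : Wuthrich2014.charIdeal_dvd_padicLFunction)
    (hp : p ≠ 2) (hgood : W.HasGoodReductionAtPrime p) (hord : ¬ (p : ℤ) ∣ W.frobeniusTrace p)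
    (hred : ¬ W.HasIrreducibleModPGaloisRep p) (hμ : X1.MuLambda.MuPartAt W p) {n k m : ℕ}
    (hlam : AnalyticLambdaEq W p n) (hm : LayerRankGEAt W p k m) (hnm : n ≤ m) :
    BirchSwinnertonDyer.Theorems.Rank1ResidualX1Defs.MazurMainConjecture W p :=
  mazurMainConjecture_of_layerRankGEAt thm19_mordellWeilRank_layer_le_lambdaInvariant_holds hW16 hp
    hgood hord hred hμ hlam hm hnm

/-- **X2 route T from a rank-growth certificate, binder-free in Thm. 1.9.**
[cite: GreenbergLNM1716, Thm. 1.9 (p. 63)] [cite: Wuthrich2014, Thm. 16 (p. 397)] -/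
theorem X2_mazurMainConjectureAt_of_layerRankGEAt'
    (hWu : Wuthrich2014.thm16_charIdeal_dvd_multiplicative_of_reducible)
    (hp2 : p ≠ 2) (hmult : W.HasMultiplicativeReductionAtPrime p)
    (hred : ¬ W.HasIrreducibleModPGaloisRep p) {n k m : ℕ}
    (hμ0 : X2.AnalyticMuLE W p 0) (hlam : X2.AnalyticLambdaEq W p n) (hm : LayerRankGEAt W p k m)
    (hkN : ¬ W.HasSplitMultiplicativeReductionAtPrime p → n ≤ m)
    (hkS : W.HasSplitMultiplicativeReductionAtPrime p → n ≤ m + 1) :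
    X2.MazurMainConjectureAt W p :=
  X2_mazurMainConjectureAt_of_layerRankGEAt thm19_mordellWeilRank_layer_le_lambdaInvariant_holds hWu
    hp2 hmult hred hμ0 hlam hm hkN hkS

end Summit.BirchSwinnertonDyer.Rank1Residual.Iwasawa
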